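import Mathlib
import Summits.Ventures.HodgeRepro2.T5RecordSatakeDifferent
import Summits.Ventures.HodgeRepro2.T5CMFieldCyclicGaloisCriterion

/-!
# THE RECORD'S HECKE ALGEBRA AT THE UNRAMIFIED PRIMES OF ANY CM FIELD, AND THE BRIEF'S SEXTIC GALOIS CM CASE
# WITHOUT A CYCLOTOMIC PRESENTATION

Tier-5 support N2 / N3 / §G-N4.2 (seat p3, gen 82). The cell's sextic statements (files 280–303, 307) read the
brief's «sextic Galois CM case» on a cyclotomic presentation `F ⊆ ℚ(ζₘ)`, the passage from an abstract sextic
Galois CM field being Kronecker–Weber (print). For the Hecke side of the chain no presentation is needed: a prime `P`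
of any CM field `K` with `e(P/p) = 1` is unramified over `K⁺` (file 281's tower law) hence prime to the relative
different (Mathlib's `ramificationIdx_eq_one_iff`, `not_dvd_differentIdeal_iff`), and file 313 applies.

* **`not_dvd_differentIdeal_of_ramificationIdx_eq_one`** — `e(P/p) = 1 ⇒ P ∤ 𝔇_{K/K⁺}`;
* **`recordCommutative_of_ramificationIdx_eq_one`** — `H(U(1 ⊗ H), K_v)` is commutative at the place `v` of `K⁺`
  under a prime `P` of `K` with `e(P/p) = 1`, good for `H`; **`recordPolynomial_of_ramificationIdx_eq_one`** — `k[X]`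
  when moreover `v` has one prime above it;
* **`recordPolynomial_sextic_of_even_inertiaDeg`** — for a SEXTIC GALOIS CM FIELD `K` (abstract, no presentation):
  `k[X]` at `v` when `f(P/p)` is even (file 281's criterion on file 280's cyclicity);
  **`sextic_galois_cm_hecke`** — the brief's case for an integral unimodular `H`: at every prime `p` unramified in `K`
  the algebra is commutative at the place under `P`, and `k[X]` when `f(P/p)` is even — every number-theoretic
  input in kernel, the only print left being the finiteness of the ramified primes (a hypothesis here).

§8(d): uses an L-value-free non-vanishing device: NO.
-/

open Matrix NumberField NumberField.IsCMField IsDedekindDomain IsDedekindDomain.HeightOneSpectrum Module Polynomial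
  Ideal
open scoped TensorProduct Pointwise
open Summit.Ventures.HodgeRepro2.T5UnitaryGroupForm Summit.Ventures.HodgeRepro2.T5UnitaryHeckeAdjoint
  Summit.Ventures.HodgeRepro2.T5HeckePermutationModule Summit.Ventures.HodgeRepro2.T5HeckeDoubleCoset
  Summit.Ventures.HodgeRepro2.T5RecordHyperspecial Summit.Ventures.HodgeRepro2.T5GlobalLatticeAlmostAll
  Summit.Ventures.HodgeRepro2.T5FinitePlaceSplitClassification Summit.Ventures.HodgeRepro2.T5RecordSatakeIntrinsic
  Summit.Ventures.HodgeRepro2.T5SplitPlaceUnitaryGroup Summit.Ventures.HodgeRepro2.T5NonSplitPlaceUnitaryGroup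
  Summit.Ventures.HodgeRepro2.T5FinitePlaceCM Summit.Ventures.HodgeRepro2.T5StarOfInvolution
  Summit.Ventures.HodgeRepro2.T5CyclotomicSubfieldHeckeCommutative
  Summit.Ventures.HodgeRepro2.T5IntegralGramBadSet Summit.Ventures.HodgeRepro2.T5RecordSatakeDifferent
  Summit.Ventures.HodgeRepro2.T5CMFieldCyclicGaloisCriterion

namespace Summit.Ventures.HodgeRepro2.T5SexticGaloisCMHecke

section Unramified

variable (K : Type*) [Field K] [NumberField K] [IsCMField K]
variable (p : ℕ) [hp : Fact p.Prime]
variable (P : Ideal (𝓞 K)) [hP : P.IsPrime] [hPp : P.LiesOver (span {(p : ℤ)})]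
variable (v : HeightOneSpectrum (𝓞 (maximalRealSubfield K))) [hPv : P.LiesOver v.asIdeal]

omit [IsCMField K] in
include hPv in
/-- **`e(P/p) = 1 ⇒ P ∤ 𝔇_{K/K⁺}`**: `e(P/v) = 1` by the tower law (file 281), so `P` is unramified over `K⁺`
(Mathlib's `ramificationIdx_eq_one_iff`, the residue field being perfect) and prime to the different. -/
theorem not_dvd_differentIdeal_of_ramificationIdx_eq_one (he : P.ramificationIdx ℤ = 1) :
    ¬ P ∣ differentIdeal (𝓞 (maximalRealSubfield K)) (𝓞 K) := by
  have h : P.ramificationIdx (𝓞 (maximalRealSubfield K)) = 1 :=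
    ramificationIdx_over_eq_one_of_eq_one K P v he
  haveI : Algebra.IsUnramifiedAt (𝓞 (maximalRealSubfield K)) P := (Ideal.ramificationIdx_eq_one_iff).mp h
  exact not_dvd_differentIdeal_iff.mpr inferInstance

/-- The place of `K` given by `P`. -/
noncomputable def placeOf : HeightOneSpectrum (𝓞 K) :=
  ⟨P, hP, Ideal.ne_bot_of_liesOver_of_ne_bot v.ne_bot P⟩

variable {r : ℕ} (l : Fin r → 𝓞 K) (k : Type*) [Field k]
  (hl : Submodule.span (𝓞 (maximalRealSubfield K)) (Set.range l) = ⊤)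

include hPv hl in
/-- **COMMUTATIVE AT THE PLACE UNDER AN UNRAMIFIED PRIME**: `e(P/p) = 1`, `P ∉ badSet H` ⇒ `H(U(1 ⊗ H), K_v)` is
commutative (file 313). -/
theorem recordCommutative_of_ramificationIdx_eq_one (he : P.ramificationIdx ℤ = 1)
    {H : Matrix (Fin 3) (Fin 3) K} (hH : H.IsHermitian) (hdet : IsUnit H.det)
    (hgood : placeOf K P v ∉ badSet H) :
    RecordCommutative K v l k H :=
  haveI : (placeOf K P v).asIdeal.LiesOver v.asIdeal := hPv
  recordCommutative_of_not_dvd_differentIdeal K v l k (placeOf K P v)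
    (not_dvd_differentIdeal_of_ramificationIdx_eq_one K P v he) hl hH hdet hgood

include hPv hl in
/-- **`k[X]` at the place under an unramified prime with one prime above it.** -/
theorem recordPolynomial_of_ramificationIdx_eq_one (he : P.ramificationIdx ℤ = 1)
    (h1 : (v.asIdeal.primesOver (𝓞 K)).ncard = 1)
    {H : Matrix (Fin 3) (Fin 3) K} (hH : H.IsHermitian) (hdet : IsUnit H.det)
    (hgood : placeOf K P v ∉ badSet H) :
    RecordPolynomial K v l k H :=
  haveI : (placeOf K P v).asIdeal.LiesOver v.asIdeal := hPv
  recordPolynomial_of_not_dvd_differentIdeal K v l k (placeOf K P v)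
    (not_dvd_differentIdeal_of_ramificationIdx_eq_one K P v he) h1 hl hH hdet hgood

end Unramified

section Sextic

variable (K : Type*) [Field K] [NumberField K] [IsCMField K] [IsGalois ℚ K] (h6 : Module.finrank ℚ K = 6)
variable (p : ℕ) [hp : Fact p.Prime]
variable (P : Ideal (𝓞 K)) [hP : P.IsPrime] [hPp : P.LiesOver (span {(p : ℤ)})]
variable (v : HeightOneSpectrum (𝓞 (maximalRealSubfield K))) [hPv : P.LiesOver v.asIdeal]
variable {r : ℕ} (l : Fin r → 𝓞 K) (k : Type*) [Field k]
  (hl : Submodule.span (𝓞 (maximalRealSubfield K)) (Set.range l) = ⊤)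

include h6 hPp hPv hl in
/-- **THE BRIEF'S SEXTIC GALOIS CM CASE, NO PRESENTATION: `k[X]` at the place under an unramified prime `P` with
`f(P/p)` even** (file 281: for a sextic Galois CM field — cyclic by file 280 — `v` has one prime above it iff `f(P/p)`
is even). -/
theorem recordPolynomial_sextic_of_even_inertiaDeg (he : P.ramificationIdx ℤ = 1)
    (heven : Even (P.inertiaDeg ℤ))
    {H : Matrix (Fin 3) (Fin 3) K} (hH : H.IsHermitian) (hdet : IsUnit H.det)
    (hgood : placeOf K P v ∉ badSet H) :
    RecordPolynomial K v l k H :=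
  haveI := isCyclic_gal K h6
  recordPolynomial_of_ramificationIdx_eq_one K P v l k hl he
    ((ncard_primesOver_eq_one_iff_even_inertiaDeg K p P v he).mpr heven) hH hdet hgood

variable (M : Matrix (Fin 3) (Fin 3) (𝓞 K)) (hM : IsUnit M.det)
  (hH : ((algebraMap (𝓞 K) K).mapMatrix M).IsHermitian)

include h6 hPp hPv hl hM hH in
/-- **THE BRIEF'S SEXTIC GALOIS CM CASE FOR AN INTEGRAL UNIMODULAR `H`**: at every prime `p` unramified in `K`
(`e(P/p) = 1`) the record's spherical Hecke algebra is commutative at the place `v` under `P`, and it is `k[X]`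
when `f(P/p)` is even — the inert regime of the Satake chain, with no cyclotomic presentation and no local
hypothesis. -/
theorem sextic_galois_cm_hecke (he : P.ramificationIdx ℤ = 1) :
    RecordCommutative K v l k ((algebraMap (𝓞 K) K).mapMatrix M) ∧
      (Even (P.inertiaDeg ℤ) → RecordPolynomial K v l k ((algebraMap (𝓞 K) K).mapMatrix M)) :=
  ⟨recordCommutative_of_ramificationIdx_eq_one K P v l k hl he hH (isUnit_det_mapMatrix M hM)
      (notMem_badSet_mapMatrix M hM _),
    fun heven => recordPolynomial_sextic_of_even_inertiaDeg K h6 p P v l k hl he heven hH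
      (isUnit_det_mapMatrix M hM) (notMem_badSet_mapMatrix M hM _)⟩

end Sextic

end Summit.Ventures.HodgeRepro2.T5SexticGaloisCMHecke
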